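import Summits.AtomisticToContinuum.Crystallization.Theorems.FrustratedLawDichotomyStrainedPatchHomValueT2SlopeSoundI

/-!
# (I1) slope part J — the SECOND-ORDER REMAINDER CHARGE `rp` of `t2SlopeT2` in `SC` units, WITH THE FLOOR CORRECTION (`…HomValueT2Track` §14b;
# critic row 1674 (B) (I1) docket item 3 `slopeT2_sound`, tenth instalment; 27623 `(H) HomFloor`; decomp-a2c hand-1 g49)

The kit's remainder numerator is the triangular fold `rp = Σ_{k≤l} wt_kl·⌊|ddF_kl|↑ wf_k/SC⌋·wf_l` (`wt = 1, 2`).  With `|δ_k| ≤ wf_k/SC`, `0 ≤ wf ≤ SC` and the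
symmetry `ddF_kl = ddF_lk`:  `½ Σ_{k,l<9} |ddF_kl|↑/SC·|δ_k||δ_l| ≤ rp/(2SC²) + 81/(2SC)` — the last term is the inner-floor loss (`≤ wt·wf_l ≤ 2SC` per
ordered pair, `Σ wt = 81`), cf. the FINDING recorded in part I.  No definitions; 0 sorry; standard axioms.  `--supports stmt-AtomisticToContinuum-27623`.
-/

noncomputable section

namespace Summit.AtomisticToContinuum.Crystallization.Theorems.FrustratedLawDichotomyStrainedPatchHomValueT2Kit

open scoped BigOperators
open Finset
open Literature.Analysis.ValidatedNumerics.Numerics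

/-- A fold that skips `l < k` is the sum with zero summands there. [formal bookkeeping] -/
theorem foldl_skip_sum (k : ℕ) (T : ℕ → ℤ) (s : ℤ) (n : ℕ) :
    (List.range n).foldl (fun s2 l => if l < k then s2 else s2 + T l) s = s + ∑ l ∈ range n, (if l < k then 0 else T l) := by
  have e : (fun (s2 : ℤ) (l : ℕ) => if l < k then s2 else s2 + T l) = fun s2 l => s2 + (if l < k then 0 else T l) := by
    funext s2 l; split_ifs <;> simp
  rw [e, foldl_add_range]

/-- The kit's triangular double fold is a double sum. [formal bookkeeping] -/
theorem rp_fold_eq (T : ℕ → ℕ → ℤ) :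
    (List.range 9).foldl (fun s k => (List.range 9).foldl (fun s2 l => if l < k then s2 else s2 + T k l) s) 0 =
      ∑ k ∈ range 9, ∑ l ∈ range 9, (if l < k then 0 else T k l) := by
  simp only [foldl_skip_sum]
  rw [foldl_add_range, zero_add]

/-- The triangular weights add up to `81`. [arithmetic] -/
theorem sum_wt_eq : ∑ k ∈ range 9, ∑ l ∈ range 9, (if l < k then (0 : ℝ) else (if k = l then (1 : ℝ) else 2)) = 81 := by
  simp only [Finset.sum_range_succ, Finset.sum_range_zero]
  norm_num

/-- ★★ **THE REMAINDER CHARGE WITH THE FLOOR CORRECTION.** [arithmetic + `ddF_symm`] -/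
theorem rp_charge_le (Rb : DRec) (a : Fin 3) (wf : Array ℤ) (hwf0 : ∀ k, 0 ≤ wf.getD k 0) (hwf1 : ∀ k, wf.getD k 0 ≤ (SC : ℤ))
    (δ : ℕ → ℝ) (hδ : ∀ k, k < 9 → |δ k| ≤ ((wf.getD k 0 : ℤ) : ℝ) / SC) :
    1 / 2 * ∑ k ∈ range 9, ∑ l ∈ range 9, (((ddF Rb a k l).absHi : ℤ) : ℝ) / SC * (|δ k| * |δ l|) ≤
      (((List.range 9).foldl (fun s k => (List.range 9).foldl (fun s2 l => if l < k then s2 else s2 + (if k = l then 1 else 2) * ((ddF Rb a k l).absHi * wf.getD k 0 / (SC : ℤ)) * wf.getD l 0) s) 0 : ℤ) : ℝ) / (2 * (SC : ℝ) * SC) + 81 / (2 * (SC : ℝ)) := by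
  have hS := SC_pos
  have hc0 : ∀ k l, (0 : ℝ) ≤ (((ddF Rb a k l).absHi : ℤ) : ℝ) := fun k l => by exact_mod_cast absHi_nonneg _
  have hv0 : ∀ k, (0 : ℝ) ≤ ((wf.getD k 0 : ℤ) : ℝ) := fun k => by exact_mod_cast hwf0 k
  have hv1 : ∀ k, ((wf.getD k 0 : ℤ) : ℝ) ≤ SC := fun k => by exact_mod_cast hwf1 k
  -- (1) `|δ| ≤ wf/SC`
  have h1 : ∑ k ∈ range 9, ∑ l ∈ range 9, (((ddF Rb a k l).absHi : ℤ) : ℝ) / SC * (|δ k| * |δ l|) ≤ (∑ k ∈ range 9, ∑ l ∈ range 9, (((ddF Rb a k l).absHi : ℤ) : ℝ) * (((wf.getD k 0 : ℤ) : ℝ) * ((wf.getD l 0 : ℤ) : ℝ))) / ((SC : ℝ) * SC * SC) := by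
    rw [Finset.sum_div]
    refine Finset.sum_le_sum fun k hk => ?_
    rw [Finset.sum_div]
    refine Finset.sum_le_sum fun l hl => ?_
    have hk9 := Finset.mem_range.1 hk
    have hl9 := Finset.mem_range.1 hl
    have hkl := mul_le_mul (hδ k hk9) (hδ l hl9) (abs_nonneg _) (div_nonneg (hv0 k) hS.le)
    calc (((ddF Rb a k l).absHi : ℤ) : ℝ) / SC * (|δ k| * |δ l|) ≤ (((ddF Rb a k l).absHi : ℤ) : ℝ) / SC * (((wf.getD k 0 : ℤ) : ℝ) / SC * (((wf.getD l 0 : ℤ) : ℝ) / SC)) :=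
          mul_le_mul_of_nonneg_left hkl (div_nonneg (hc0 k l) hS.le)
      _ = (((ddF Rb a k l).absHi : ℤ) : ℝ) * (((wf.getD k 0 : ℤ) : ℝ) * ((wf.getD l 0 : ℤ) : ℝ)) / ((SC : ℝ) * SC * SC) := by
          field_simp
  -- (2) symmetrisation onto the triangle
  have h2 : ∑ k ∈ range 9, ∑ l ∈ range 9, (((ddF Rb a k l).absHi : ℤ) : ℝ) * (((wf.getD k 0 : ℤ) : ℝ) * ((wf.getD l 0 : ℤ) : ℝ)) = ∑ k ∈ range 9, ∑ l ∈ range 9, (if l < k then 0 else (if k = l then (1 : ℝ) else 2) * ((((ddF Rb a k l).absHi : ℤ) : ℝ) * (((wf.getD k 0 : ℤ) : ℝ) * ((wf.getD l 0 : ℤ) : ℝ)))) := by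
    have TU : ∑ k ∈ range 9, ∑ l ∈ range 9, (if l < k then (((ddF Rb a k l).absHi : ℤ) : ℝ) * (((wf.getD k 0 : ℤ) : ℝ) * ((wf.getD l 0 : ℤ) : ℝ)) else 0) =
        ∑ k ∈ range 9, ∑ l ∈ range 9, (if k < l then (((ddF Rb a k l).absHi : ℤ) : ℝ) * (((wf.getD k 0 : ℤ) : ℝ) * ((wf.getD l 0 : ℤ) : ℝ)) else 0) := by
      rw [Finset.sum_comm]
      refine Finset.sum_congr rfl fun k hk => Finset.sum_congr rfl fun l hl => ?_
      split_ifs with h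
      · rw [ddF_symm Rb a (Finset.mem_range.1 hl) (Finset.mem_range.1 hk), mul_comm ((wf.getD l 0 : ℤ) : ℝ) ((wf.getD k 0 : ℤ) : ℝ)]
      · rfl
    have eS : ∑ k ∈ range 9, ∑ l ∈ range 9, (((ddF Rb a k l).absHi : ℤ) : ℝ) * (((wf.getD k 0 : ℤ) : ℝ) * ((wf.getD l 0 : ℤ) : ℝ)) = ∑ k ∈ range 9, ∑ l ∈ range 9, (if l < k then (((ddF Rb a k l).absHi : ℤ) : ℝ) * (((wf.getD k 0 : ℤ) : ℝ) * ((wf.getD l 0 : ℤ) : ℝ)) else 0) +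
        ∑ k ∈ range 9, ∑ l ∈ range 9, (if l < k then 0 else (((ddF Rb a k l).absHi : ℤ) : ℝ) * (((wf.getD k 0 : ℤ) : ℝ) * ((wf.getD l 0 : ℤ) : ℝ))) := by
      rw [← Finset.sum_add_distrib]
      refine Finset.sum_congr rfl fun k _ => ?_
      rw [← Finset.sum_add_distrib]
      exact Finset.sum_congr rfl fun l _ => by split_ifs <;> simp
    have eT : ∑ k ∈ range 9, ∑ l ∈ range 9, (if l < k then 0 else (if k = l then (1 : ℝ) else 2) * ((((ddF Rb a k l).absHi : ℤ) : ℝ) * (((wf.getD k 0 : ℤ) : ℝ) * ((wf.getD l 0 : ℤ) : ℝ)))) = ∑ k ∈ range 9, ∑ l ∈ range 9, (if k < l then (((ddF Rb a k l).absHi : ℤ) : ℝ) * (((wf.getD k 0 : ℤ) : ℝ) * ((wf.getD l 0 : ℤ) : ℝ)) else 0) +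
        ∑ k ∈ range 9, ∑ l ∈ range 9, (if l < k then 0 else (((ddF Rb a k l).absHi : ℤ) : ℝ) * (((wf.getD k 0 : ℤ) : ℝ) * ((wf.getD l 0 : ℤ) : ℝ))) := by
      rw [← Finset.sum_add_distrib]
      refine Finset.sum_congr rfl fun k _ => ?_
      rw [← Finset.sum_add_distrib]
      refine Finset.sum_congr rfl fun l _ => ?_
      by_cases hlk : l < k
      · have hkl : ¬ k < l := by omega
        simp [hlk, hkl]
      · by_cases hkl : k = l
        · subst hkl; simp
        · have hkl' : k < l := by omega
          simp [hlk, hkl, hkl']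
          ring
    rw [eS, eT, TU]
  -- (3) the floor loss, ordered pair by ordered pair
  have h3 : ∑ k ∈ range 9, ∑ l ∈ range 9, (if l < k then 0 else (if k = l then (1 : ℝ) else 2) * ((((ddF Rb a k l).absHi : ℤ) : ℝ) * (((wf.getD k 0 : ℤ) : ℝ) * ((wf.getD l 0 : ℤ) : ℝ)))) ≤ (SC : ℝ) * (((∑ k ∈ range 9, ∑ l ∈ range 9, (if l < k then 0 else (if k = l then 1 else 2) * ((ddF Rb a k l).absHi * wf.getD k 0 / (SC : ℤ)) * wf.getD l 0) : ℤ) : ℝ) + 81 * SC) := by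
    rw [← sum_wt_eq, Finset.sum_mul]
    push_cast
    rw [← Finset.sum_add_distrib, Finset.mul_sum]
    refine Finset.sum_le_sum fun k hk => ?_
    rw [Finset.sum_mul, ← Finset.sum_add_distrib, Finset.mul_sum]
    refine Finset.sum_le_sum fun l hl => ?_
    have hF := fdiv_ge_sub_one (x := (ddF Rb a k l).absHi * wf.getD k 0) SCZ_pos
    push_cast at hF
    have a1 : (((ddF Rb a k l).absHi : ℤ) : ℝ) * ((wf.getD k 0 : ℤ) : ℝ) ≤ SC * ((((ddF Rb a k l).absHi * wf.getD k 0 / (SC : ℤ) : ℤ) : ℝ) + 1) := by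
      rw [sub_le_iff_le_add, div_le_iff₀ hS] at hF; linarith
    have a2 := mul_le_mul_of_nonneg_right a1 (hv0 l)
    have a3 := mul_le_mul_of_nonneg_left (hv1 l) hS.le
    have a4 : (0 : ℝ) ≤ SC * ((((ddF Rb a k l).absHi * wf.getD k 0 / (SC : ℤ) : ℤ) : ℝ) + 1) * ((wf.getD l 0 : ℤ) : ℝ) :=
      le_trans (mul_nonneg (mul_nonneg (hc0 k l) (hv0 k)) (hv0 l)) a2
    split_ifs with hlk hkl
    · simp
    · subst hkl
      nlinarith [a2, a3, a4, hv0 k, hS]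
    · nlinarith [a2, a3, a4, hv0 l, hS]
  -- (4) combine
  rw [rp_fold_eq]
  have h4 : (∑ k ∈ range 9, ∑ l ∈ range 9, (((ddF Rb a k l).absHi : ℤ) : ℝ) * (((wf.getD k 0 : ℤ) : ℝ) * ((wf.getD l 0 : ℤ) : ℝ))) / ((SC : ℝ) * SC * SC) ≤
      ((∑ k ∈ range 9, ∑ l ∈ range 9, (if l < k then 0 else (if k = l then 1 else 2) * ((ddF Rb a k l).absHi * wf.getD k 0 / (SC : ℤ)) * wf.getD l 0) : ℤ) : ℝ) / ((SC : ℝ) * SC) + 81 / SC := by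
    rw [h2, div_le_iff₀ (by positivity)]
    refine h3.trans (le_of_eq ?_)
    field_simp
  have e : ((∑ k ∈ range 9, ∑ l ∈ range 9, (if l < k then 0 else (if k = l then 1 else 2) * ((ddF Rb a k l).absHi * wf.getD k 0 / (SC : ℤ)) * wf.getD l 0) : ℤ) : ℝ) /
        (2 * (SC : ℝ) * SC) + 81 / (2 * (SC : ℝ)) =
      1 / 2 * (((∑ k ∈ range 9, ∑ l ∈ range 9, (if l < k then 0 else (if k = l then 1 else 2) * ((ddF Rb a k l).absHi * wf.getD k 0 / (SC : ℤ)) * wf.getD l 0) : ℤ) : ℝ) /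
        ((SC : ℝ) * SC) + 81 / SC) := by
    ring
  rw [e]
  linarith [h1, h4]

end Summit.AtomisticToContinuum.Crystallization.Theorems.FrustratedLawDichotomyStrainedPatchHomValueT2Kit
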